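import Summits.Schanuel.Schanuel.Theorems.ZilberEacEdgeTransportPoly
import Summits.Schanuel.Schanuel.Theorems.ZilberEacBottomEdgePointsSector
import Summits.Schanuel.Schanuel.Theorems.ZilberEacGuardMonomialChange
import HarnessLib

/-!
# The exponential-polynomial regime, CXXVI: DENSITY ALONG AN EQUAL-ORDER PLACE OF NON-REAL
# DIRECTION FOR EVERY FIBRE RELATION (S-form of the complete verdict, O93)

HONEST FRAMING.  Cell `pub-schanuel` (Zilber's Exponential-Algebraic Closedness, case ladder;
host summit Schanuel), seat 2, gen 35.  `F` irreducible with an EQUAL-ORDER place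
`x₀ = s^{-k}`, `x₁ = Φ(s)s^{-k}` of NON-REAL direction `Im Φ(0) ≠ 0` (e.g. every branch of a
curve at a non-real point at infinity: Fermat curves, the circle); `P ∈ ℂ[x₀, x₁, y₁][y₀]` ANY
relation of positive degree with `F ∤ lc(P)`, `F ∤ P(0)` — NO Newton-polygon hypothesis.  Every
irreducible closed `S` of dimension `≤ 2` containing the points `(x, y₀, y₁)` with `x ∈ C`,
`y₀, y₁ ≠ 0`, `lc(P)(x, y₁) ≠ 0`, `P(x, y₁; y₀) = 0` has Zariski-dense exponential points:
**`unprojectedDense_nonRealPlace_relation`**.  Proof: transport the lower Newton edge of `P`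
(file CXXV) to the bottom edge by `U = (εa εb; c d)`, the sign `ε` chosen so that the
transported direction `Φ'(0) = (c + dΦ(0))/(ε(a + bΦ(0)))` has `Im Φ'(0) > 0`, i.e. `z^k = 2πi`
is a degenerate direction; run the bottom-edge engine with the sector estimate (file CXXIII) on
the transported data; pull the exponential points back by `y = y'^{V}` (they stay exponential);
the guard holds by file CXXIV; the pulled-back `x₁` grows linearly.  Decided S-form of an OPEN
question (Mantova–Masser PLMS 2024 §1 p. 5); EC(3,2) OPEN; NOT Schanuel's conjecture (neither
used nor implied); EAC ⇏ SC.
-/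

noncomputable section

open Filter Topology Metric Complex Polynomial
open Literature.NumberTheory.Transcendental Literature.ModelTheory.Zilber
open Literature.ModelTheory.ExponentialFields

set_option linter.dupNamespace false

namespace Summit.Schanuel.Schanuel.Theorems

section NonRealPlacePoints

variable (F : ℂ[X][X])

/-- The imaginary part of a unimodular Möbius image: `Im((c + dΦ)/(a + bΦ)) = Im Φ/|a + bΦ|²`
when `ad − bc = 1`. [folklore] -/
theorem im_moebius_unimodular {a b c d : ℤ} (hdet : a * d - b * c = 1) (Φ₀ : ℂ)
    (hw : (a : ℂ) + b * Φ₀ ≠ 0) :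
    (((c : ℂ) + d * Φ₀) / ((a : ℂ) + b * Φ₀)).im = Φ₀.im / Complex.normSq ((a : ℂ) + b * Φ₀) := by
  have hn : Complex.normSq ((a : ℂ) + b * Φ₀) ≠ 0 := fun h => hw (Complex.normSq_eq_zero.1 h)
  have hdetR : (a : ℝ) * d - b * c = 1 := by exact_mod_cast hdet
  rw [Complex.div_im]
  have hnum : ((c : ℂ) + d * Φ₀).im * ((a : ℂ) + b * Φ₀).re -
      ((c : ℂ) + d * Φ₀).re * ((a : ℂ) + b * Φ₀).im = Φ₀.im := by
    simp only [Complex.add_re, Complex.add_im, Complex.mul_re, Complex.mul_im, Complex.intCast_re,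
      Complex.intCast_im, zero_mul, sub_zero, zero_add, add_zero]
    linear_combination Φ₀.im * hdetR
  rw [← hnum]
  field_simp

/-- **DENSITY ALONG AN EQUAL-ORDER PLACE OF NON-REAL DIRECTION, FOR EVERY FIBRE RELATION
(S-form).**  See the module docstring. [cite: MantovaMasser2023, §1 Further remarks, p. 5 (the
question, open in general)] (new) -/
theorem unprojectedDense_nonRealPlace_relation (hFirr : Irreducible F) {k : ℕ} (hk : 1 ≤ k)
    {Φ : ℂ → ℂ} (hΦan : AnalyticAt ℂ Φ 0)
    (hplace : ∀ᶠ s in 𝓝[≠] (0 : ℂ),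
      (F.map (Polynomial.evalRingHom (s ^ k)⁻¹)).eval (Φ s * (s ^ k)⁻¹) = 0)
    (hΦ : (Φ 0).im ≠ 0) (F₃ : MvPolynomial (Fin 3) ℂ)
    (hF₃ : ∀ v : Fin 3 → ℂ, MvPolynomial.eval v F₃ = (F.map (Polynomial.evalRingHom (v 0))).eval (v 1))
    (P : Polynomial (MvPolynomial (Fin 3) ℂ)) (hd : 1 ≤ P.natDegree)
    (htop : ¬ F₃ ∣ P.leadingCoeff) (hbot : ¬ F₃ ∣ P.coeff 0)
    {S : Set (Fin 2 ⊕ Fin 2 → ℂ)} (hS : IsIrreducibleClosed ℂ S) (hdim : zariskiDim ℂ S ≤ (2 : ℕ))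
    (hsub : ∀ x₀ x₁ y₀ y₁ : ℂ, (F.map (Polynomial.evalRingHom x₀)).eval x₁ = 0 → y₀ ≠ 0 → y₁ ≠ 0 →
      MvPolynomial.eval ![x₀, x₁, y₁] P.leadingCoeff ≠ 0 →
      (P.map (MvPolynomial.eval ![x₀, x₁, y₁])).eval y₀ = 0 →
      (Sum.elim ![x₀, x₁] ![y₀, y₁] : Fin 2 ⊕ Fin 2 → ℂ) ∈ S) :
    UnprojectedDense S := by
  classical
  have hk0 : k ≠ 0 := by omega
  -- the sign prescription
  set sgn : ℤ → ℤ → ℤ → ℤ → ℤ := fun a b c d =>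
    if 0 < ((((c : ℂ) + d * Φ 0) / ((a : ℂ) + b * Φ 0))).im then 1 else -1 with hsgn
  have hsgn1 : ∀ a b c d, sgn a b c d = 1 ∨ sgn a b c d = -1 := by
    intro a b c d; simp only [hsgn]; split_ifs <;> simp
  -- the transported data (file CXXV)
  obtain ⟨a, b, c, d, ε, τ, G', G₀', cQ, n₀, n₁, ha, hdet, hε, hτ, hG₀', h2', hG'ev, hcQ, hcQev⟩ :=
    exists_edgeTransport F F₃ hF₃ P hd htop hbot sgn hsgn1
  have hε1 : ε = 1 ∨ ε = -1 := by rw [hε]; exact hsgn1 a b c d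
  have hε2 : ε * ε = 1 := by rcases hε1 with h | h <;> rw [h] <;> norm_num
  set U : Matrix (Fin 2) (Fin 2) ℤ := !![ε * a, ε * b; c, d] with hU
  set V : Matrix (Fin 2) (Fin 2) ℤ := !![ε * d, -b; -ε * c, a] with hV
  have hVU : V * U = 1 := by
    have e1 : ε * d * (ε * a) + -b * c = 1 := by
      linear_combination (a * d) * hε2 + hdet
    have e2 : ε * d * (ε * b) + -b * d = 0 := by linear_combination (b * d) * hε2
    have e3 : -ε * c * (ε * a) + a * c = 0 := by linear_combination -(a * c) * hε2
    have e4 : -ε * c * (ε * b) + a * d = 1 := by linear_combination -(b * c) * hε2 + hdet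
    rw [hU, hV, Matrix.mul_fin_two, e1, e2, e3, e4, Matrix.one_fin_two]
  have hV0 : ∀ x : Fin 2 → ℂ, intLinMap V x 0 = ((ε * d : ℤ) : ℂ) * x 0 + ((-b : ℤ) : ℂ) * x 1 := by
    intro x; simp [intLinMap, Fin.sum_univ_two, hV]
  have hV1 : ∀ x : Fin 2 → ℂ, intLinMap V x 1 = ((-(ε * c) : ℤ) : ℂ) * x 0 + ((a : ℤ) : ℂ) * x 1 := by
    intro x; simp [intLinMap, Fin.sum_univ_two, hV]
  -- the transported curve
  set F' : ℂ[X][X] := τ F with hF'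
  have hF'irr : Irreducible F' := (MulEquiv.irreducible_iff τ.toMulEquiv).2 hFirr
  have hF'0 : F' ≠ 0 := hF'irr.ne_zero
  have hF'ev : ∀ x : Fin 2 → ℂ, (F'.map (Polynomial.evalRingHom (x 0))).eval (x 1) =
      (F.map (Polynomial.evalRingHom (intLinMap V x 0))).eval (intLinMap V x 1) := fun x => hτ F x
  -- the transported place
  set w₀ : ℂ := (a : ℂ) + b * Φ 0 with hw₀
  have hw₀0 : w₀ ≠ 0 := by
    intro h
    have him : (b : ℝ) * (Φ 0).im = 0 := by
      have := congrArg Complex.im h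
      simpa [hw₀] using this
    have hb : (b : ℝ) = 0 := by
      rcases mul_eq_zero.1 him with h1 | h1
      · exact h1
      · exact absurd h1 hΦ
    have hb' : b = 0 := by exact_mod_cast hb
    have hre := congrArg Complex.re h
    simp [hw₀, hb'] at hre
    have : (1 : ℤ) ≤ a := ha
    have : (a : ℝ) = 0 := by exact_mod_cast hre
    have : (a : ℤ) = 0 := by exact_mod_cast this
    omega
  have hU00 : U 0 0 = ε * a := rfl
  have hU01 : U 0 1 = ε * b := rfl
  have hU10 : U 1 0 = c := rfl
  have hU11 : U 1 1 = d := rfl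
  have hεC0 : (ε : ℂ) ≠ 0 := by
    rcases hε1 with h | h <;> rw [h] <;> norm_num
  have hUΦ : ((U 0 0 : ℤ) : ℂ) + ((U 0 1 : ℤ) : ℂ) * Φ 0 ≠ 0 := by
    rw [hU00, hU01]
    push_cast
    rw [show (ε : ℂ) * a + ε * b * Φ 0 = ε * w₀ by rw [hw₀]; ring]
    exact mul_ne_zero hεC0 hw₀0
  obtain ⟨Φ', hΦ'an, hΦ'0, hplace'⟩ := exists_transportedPlace F hk hΦan hplace hVU hUΦ F' hF'ev
  have hn' : 1 ≤ F'.natDegree := natDegree_pos_of_place F' hF'0 hk k hplace'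
  -- the direction: `Im Φ'(0) > 0`
  have hΦ'0' : Φ' 0 = (ε : ℂ) * (((c : ℂ) + d * Φ 0) / w₀) := by
    rw [hΦ'0, hU00, hU01, hU10, hU11]
    push_cast
    rw [show (ε : ℂ) * a + ε * b * Φ 0 = ε * w₀ by rw [hw₀]; ring]
    rcases hε1 with h | h
    · rw [h]; push_cast; rw [one_mul, one_mul]
    · rw [h]; push_cast; rw [neg_one_mul, neg_one_mul, div_neg]
  have him : 0 < (Φ' 0).im := by
    have hq : ((((c : ℂ) + d * Φ 0) / w₀)).im = (Φ 0).im / Complex.normSq w₀ :=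
      im_moebius_unimodular hdet (Φ 0) hw₀0
    have hq0 : ((((c : ℂ) + d * Φ 0) / w₀)).im ≠ 0 := by
      rw [hq]
      exact div_ne_zero hΦ (fun h => hw₀0 (Complex.normSq_eq_zero.1 h))
    rw [hΦ'0']
    have hsgn' : ε = sgn a b c d := hε
    simp only [hsgn] at hsgn'
    by_cases hpos : 0 < ((((c : ℂ) + d * Φ 0) / ((a : ℂ) + b * Φ 0))).im
    · rw [if_pos hpos] at hsgn'
      rw [hsgn']; push_cast; rw [one_mul]; exact hpos
    · rw [if_neg hpos] at hsgn'
      rw [hsgn']; push_cast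
      rw [show ((-1 : ℂ) * (((c : ℂ) + d * Φ 0) / w₀)).im = -((((c : ℂ) + d * Φ 0) / w₀)).im by
        simp]
      have : ((((c : ℂ) + d * Φ 0) / w₀)).im < 0 := lt_of_le_of_ne (not_lt.1 hpos) hq0
      linarith
  obtain ⟨z, hz⟩ := IsAlgClosed.exists_pow_nat_eq (2 * Real.pi * I : ℂ) (by omega : 0 < k)
  have hdir' : (Φ' 0 * z ^ k).re < 0 := by
    rw [hz]
    have : (Φ' 0 * (2 * Real.pi * I)).re = -(2 * Real.pi) * (Φ' 0).im := by
      simp [Complex.mul_re]; ring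
    rw [this]
    have := Real.pi_pos
    nlinarith
  -- the engine with the sector estimate (file CXXIII) on the transported data
  obtain ⟨p, c₀, hc₀, hp0, hp, hF'p, hre, hnorm, hG'p, hsector⟩ :=
    exists_expPoints_bottomEdge_sector F' hF'irr hn' hk hk hΦ'an hplace' hz hdir' G' G₀'
      (fun x₀ x₁ y _ => hG₀' x₀ x₁ y) h2'
  -- the guard (file CXXIV)
  have haq : (1 : ℤ) ≤ a := ha
  obtain ⟨ε₁, hε₁, hguard⟩ :=
    eventually_guard_ne_zero_zpow F' hF'irr hn' hk hk hΦ'an hplace' cQ hcQ (-(ε * c)) haq hc₀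
  -- thresholds along the sequence
  have hpW : Tendsto p atTop (𝓝[≠] (0 : ℂ)) :=
    tendsto_nhdsWithin_iff.2 ⟨hp, Eventually.of_forall hp0⟩
  set ε₂ : ℝ := c₀ / (2 * (|(c : ℝ)| + 1)) with hε₂
  have hε₂pos : 0 < ε₂ := by positivity
  have hε₂le : |(c : ℝ)| * ε₂ ≤ c₀ / 2 := by
    have hden : 0 < 2 * (|(c : ℝ)| + 1) := by positivity
    rw [hε₂, ← mul_div_assoc, div_le_iff₀ hden]
    have e : c₀ / 2 * (2 * (|(c : ℝ)| + 1)) = |(c : ℝ)| * c₀ + c₀ := by ring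
    rw [e]; linarith
  obtain ⟨J₀, hJ₀⟩ := Filter.eventually_atTop.1
    ((hpW.eventually hguard).and ((hsector ε₁ hε₁).and (hsector ε₂ hε₂pos)))
  -- the pulled-back exponential points
  set x₀' : ℕ → ℂ := fun m => (p (J₀ + m) ^ k)⁻¹ with hx₀'
  set x₁' : ℕ → ℂ := fun m => Φ' (p (J₀ + m)) * (p (J₀ + m) ^ k)⁻¹ with hx₁'
  set Λ : ℕ → ℂ := fun m => Complex.exp (x₀' m) with hΛ
  set yy : ℕ → ℂ := fun m => Complex.exp (x₁' m) with hyy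
  set X₀ : ℕ → ℂ := fun m => ((ε * d : ℤ) : ℂ) * x₀' m + ((-b : ℤ) : ℂ) * x₁' m with hX₀
  set X₁ : ℕ → ℂ := fun m => ((-(ε * c) : ℤ) : ℂ) * x₀' m + ((a : ℤ) : ℂ) * x₁' m with hX₁
  set Pt : ℕ → Fin 2 ⊕ Fin 2 → ℂ := fun m =>
    Sum.elim ![X₀ m, X₁ m] ![Λ m ^ (ε * d) * yy m ^ (-b), Λ m ^ (-(ε * c)) * yy m ^ a] with hPt
  have hΛ0 : ∀ m, Λ m ≠ 0 := fun m => Complex.exp_ne_zero _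
  have hyy0 : ∀ m, yy m ≠ 0 := fun m => Complex.exp_ne_zero _
  have hVx : ∀ m, intLinMap V ![x₀' m, x₁' m] 0 = X₀ m ∧ intLinMap V ![x₀' m, x₁' m] 1 = X₁ m := by
    intro m
    refine ⟨?_, ?_⟩
    · rw [hV0]; simp [hX₀]
    · rw [hV1]; simp [hX₁]
  -- exponential points
  have hPΓ : ∀ m, Pt m ∈ expGraph ℂ 2 := by
    intro m
    rw [mem_expGraph_iff]
    intro i
    rw [Literature.ModelTheory.ExponentialFields.ExponentialRing.complex_exp_eq]
    fin_cases i
    · show Λ m ^ (ε * d) * yy m ^ (-b) = Complex.exp (X₀ m)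
      rw [hX₀]
      simp only
      rw [Complex.exp_add, Complex.exp_int_mul, Complex.exp_int_mul]
    · show Λ m ^ (-(ε * c)) * yy m ^ a = Complex.exp (X₁ m)
      rw [hX₁]
      simp only
      rw [Complex.exp_add, Complex.exp_int_mul, Complex.exp_int_mul]
  -- points of `S`
  have hPS : ∀ m, Pt m ∈ S := by
    intro m
    obtain ⟨hgj, hs₁, -⟩ := hJ₀ (J₀ + m) (Nat.le_add_right _ _)
    have hFx : (F.map (Polynomial.evalRingHom (X₀ m))).eval (X₁ m) = 0 := by
      have h := hF'ev ![x₀' m, x₁' m]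
      rw [(hVx m).1, (hVx m).2] at h
      simp only [Matrix.cons_val_zero, Matrix.cons_val_one] at h
      rw [← h]
      exact hF'p (J₀ + m)
    refine hsub (X₀ m) (X₁ m) _ _ hFx (mul_ne_zero (zpow_ne_zero _ (hΛ0 m)) (zpow_ne_zero _ (hyy0 m)))
      (mul_ne_zero (zpow_ne_zero _ (hΛ0 m)) (zpow_ne_zero _ (hyy0 m))) ?_ ?_
    · -- the guard
      have h := hcQev ![x₀' m, x₁' m] (Λ m) (yy m) (hΛ0 m) (hyy0 m)
      rw [(hVx m).1, (hVx m).2] at h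
      rw [h]
      simp only [Matrix.cons_val_zero, Matrix.cons_val_one]
      refine hgj (Λ m) (yy m) (hΛ0 m) ?_ (hyy0 m) ?_
      · -- `|log |Λ|| = |Re x₀'| ≤ ε₁ |p|^{-k}`
        rw [hΛ]
        simp only
        rw [Complex.norm_exp, Real.log_exp]
        exact hs₁
      · rw [hyy]
        simp only
        rw [Complex.norm_exp]
        refine Real.exp_le_exp.2 ?_
        have := hre (J₀ + m)
        linarith
    · -- the relation `P = 0` from `G' = 0`
      have h := hG'ev ![x₀' m, x₁' m] (Λ m) (yy m) (hΛ0 m) (hyy0 m)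
      rw [(hVx m).1, (hVx m).2] at h
      have h0 := h hFx
      simp only [Matrix.cons_val_zero, Matrix.cons_val_one] at h0
      have hG0 : (G'.map (MvPolynomial.eval ![x₀' m, x₁' m, yy m])).eval (Λ m) = 0 := hG'p (J₀ + m)
      rw [hG0] at h0
      have hne : Λ m ^ n₀ * yy m ^ n₁ ≠ 0 :=
        mul_ne_zero (zpow_ne_zero _ (hΛ0 m)) (zpow_ne_zero _ (hyy0 m))
      exact (mul_eq_zero.1 h0.symm).resolve_left hne
  -- growth of the pulled-back `x₁`
  set L : ℕ → ℝ := fun m => c₀ / 2 * ‖p (J₀ + m)‖⁻¹ ^ k with hL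
  have hpJ : Tendsto (fun m => p (J₀ + m)) atTop (𝓝 0) :=
    hp.comp ((tendsto_add_atTop_nat J₀).congr fun m => Nat.add_comm m J₀)
  have hLtop : Tendsto L atTop atTop := by
    have h1 : Tendsto (fun m => ‖p (J₀ + m)‖⁻¹) atTop atTop := by
      have h2 : Tendsto (fun m => ‖p (J₀ + m)‖) atTop (𝓝[>] 0) :=
        tendsto_nhdsWithin_iff.2 ⟨by simpa using hpJ.norm,
          Eventually.of_forall fun m => norm_pos_iff.2 (hp0 _)⟩
      exact tendsto_inv_nhdsGT_zero.comp h2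
    exact (tendsto_pow_atTop hk0 |>.comp h1).const_mul_atTop (half_pos hc₀)
  have hx₀'n : ∀ m, ‖x₀' m‖ = ‖p (J₀ + m)‖⁻¹ ^ k := by
    intro m; rw [hx₀']; simp [norm_inv, norm_pow, inv_pow]
  have hgr : Tendsto (fun m => |(Pt m (Sum.inl 1)).re| / Real.log (2 + ‖Pt m (Sum.inl 1)‖))
      atTop atTop := by
    refine tendsto_abs_re_div_log_of_escape hLtop
      (A := (|(c : ℝ)| + a * (‖Φ' 0‖ + 1)) / (c₀ / 2)) (fun m => ?_) (fun m => ?_)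
    · -- `Re x₁ ≤ -L`
      obtain ⟨-, -, hs₂⟩ := hJ₀ (J₀ + m) (Nat.le_add_right _ _)
      show (X₁ m).re ≤ -L m
      rw [hX₁, hL]
      simp only [Complex.add_re, Complex.mul_re, Complex.intCast_re, Complex.intCast_im, zero_mul,
        sub_zero]
      have h1 : ((-(ε * c) : ℤ) : ℝ) * (x₀' m).re ≤ |(c : ℝ)| * (ε₂ * ‖p (J₀ + m)‖⁻¹ ^ k) := by
        have hεabs : |((-(ε * c) : ℤ) : ℝ)| = |(c : ℝ)| := by
          rcases hε1 with h | h <;> simp [h]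
        calc ((-(ε * c) : ℤ) : ℝ) * (x₀' m).re ≤ |((-(ε * c) : ℤ) : ℝ) * (x₀' m).re| := le_abs_self _
          _ = |(c : ℝ)| * |(x₀' m).re| := by rw [abs_mul, hεabs]
          _ ≤ |(c : ℝ)| * (ε₂ * ‖p (J₀ + m)‖⁻¹ ^ k) :=
              mul_le_mul_of_nonneg_left hs₂ (abs_nonneg _)
      have h2 : ((a : ℤ) : ℝ) * (x₁' m).re ≤ -(c₀ * ‖p (J₀ + m)‖⁻¹ ^ k) := by
        have ha1 : (1 : ℝ) ≤ ((a : ℤ) : ℝ) := by exact_mod_cast ha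
        have hre' := hre (J₀ + m)
        have hX : 0 ≤ c₀ * ‖p (J₀ + m)‖⁻¹ ^ k := by positivity
        have : (x₁' m).re ≤ -(c₀ * ‖p (J₀ + m)‖⁻¹ ^ k) := by rw [hx₁']; simpa using hre'
        nlinarith
      have h3 : |(c : ℝ)| * (ε₂ * ‖p (J₀ + m)‖⁻¹ ^ k) ≤ c₀ / 2 * ‖p (J₀ + m)‖⁻¹ ^ k := by
        rw [← mul_assoc]
        exact mul_le_mul_of_nonneg_right hε₂le (by positivity)
      push_cast at h1 h2 ⊢
      linarith
    · -- `|x₁| ≤ A L`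
      show ‖X₁ m‖ ≤ (|(c : ℝ)| + a * (‖Φ' 0‖ + 1)) / (c₀ / 2) * L m
      rw [hL, show (|(c : ℝ)| + a * (‖Φ' 0‖ + 1)) / (c₀ / 2) * (c₀ / 2 * ‖p (J₀ + m)‖⁻¹ ^ k) =
        (|(c : ℝ)| + a * (‖Φ' 0‖ + 1)) * ‖p (J₀ + m)‖⁻¹ ^ k by field_simp]
      rw [hX₁]
      simp only
      have ha0 : (0 : ℝ) ≤ ((a : ℤ) : ℝ) := by exact_mod_cast (by omega : (0 : ℤ) ≤ a)
      calc ‖((-(ε * c) : ℤ) : ℂ) * x₀' m + ((a : ℤ) : ℂ) * x₁' m‖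
          ≤ ‖((-(ε * c) : ℤ) : ℂ) * x₀' m‖ + ‖((a : ℤ) : ℂ) * x₁' m‖ := norm_add_le _ _
        _ = |(c : ℝ)| * ‖p (J₀ + m)‖⁻¹ ^ k + a * ‖x₁' m‖ := by
            rw [norm_mul, norm_mul, hx₀'n, Complex.norm_intCast, Complex.norm_intCast]
            have hεabs : |((-(ε * c) : ℤ) : ℝ)| = |(c : ℝ)| := by
              rcases hε1 with h | h <;> simp [h]
            rw [hεabs, abs_of_nonneg ha0]
        _ ≤ |(c : ℝ)| * ‖p (J₀ + m)‖⁻¹ ^ k + a * ((‖Φ' 0‖ + 1) * ‖p (J₀ + m)‖⁻¹ ^ k) := by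
            have := hnorm (J₀ + m)
            have h' : ‖x₁' m‖ ≤ (‖Φ' 0‖ + 1) * ‖p (J₀ + m)‖⁻¹ ^ k := by rw [hx₁']; exact this
            nlinarith
        _ = (|(c : ℝ)| + a * (‖Φ' 0‖ + 1)) * ‖p (J₀ + m)‖⁻¹ ^ k := by ring
  exact unprojectedDense_of_growth hS hdim 1 hPS hPΓ hgr

end NonRealPlacePoints

end Summit.Schanuel.Schanuel.Theorems

end
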